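import Literature.Barriers.PneNP.TSPExtensionComplexity
import Mathlib.Algebra.BigOperators.Field
import HarnessLib

/-!
# Farkas' lemma and LP duality for extended formulations in slack form

Support file for the extension-complexity barrier facts of
`Literature.Barriers.PneNP.TSPExtensionComplexity` (Yannakakis 1991; FMPTW 2015; Rothvoß 2017).
The one non-elementary input of Yannakakis' factorization theorem ("`xc(P) = rk₊(S)`", FMPTW
Thm. 3 = Rothvoß Thm. 4) in the direction *extended formulation ⇒ nonnegative factorization* is
LP duality: "By LP duality we know that each constraint `a_i x ≤ b_i` [valid for the projection]
can be derived as a conic combination of the system" (Rothvoß 2017, proof of Thm. 4, PDF p. 5;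
FMPTW Lemma 2 = Farkas). Mathlib (v4.32) has the Hahn–Banach form of Farkas' lemma for CLOSED
(`ProperCone`) cones only, and neither the closedness of finitely generated cones nor the
Minkowski–Weyl theorem, so the polyhedral statement is proved here from scratch, purely
algebraically:

* `farkas_fin`, `farkas` — the conic Farkas alternative for finitely many generators
  `a_g ∈ ℝ^κ`: either `b = Σ λ_g a_g` with `λ ≥ 0`, or some `y` has `⟨a_g, y⟩ ≥ 0` for all `g`
  and `⟨b, y⟩ < 0`. Proof by induction on the number of generators (project along the last
  generator; the classical elimination argument), no topology.
* `ExtendedFormulation.exists_multipliers` — LP duality for a slack-form system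
  `E x + F y = g, y ≥ 0` with nonempty feasible region: if `c · x ≤ β` holds on its projection,
  then there are multipliers `λ` (free sign) with `λᵀE = c`, `λᵀF ≥ 0`, `λᵀg ≤ β`.

Everything here is generic (any finite coordinate type) and reused by the factorization /
hyperplane-separation file.

Sources: [Rothvoss2017] Thm. 4 and its proof (PDF p. 5); [FioriniEtAl2015] Lemma 2 (Farkas),
Thm. 3 (PDF p. 8). The inductive proof of Farkas' lemma is folklore (e.g. the elimination proof
in Schrijver, *Theory of Linear and Integer Programming*, §7.3, Cor. 7.1e).
-/

noncomputable section

namespace Literature.Barriers.PneNP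

open Matrix Finset

section Farkas

variable {κ : Type*} [Fintype κ]

/-- **Farkas' lemma, conic form, generators indexed by `Fin m`.** For `a_0, …, a_{m-1}, b ∈ ℝ^κ`:
either `b` is a nonnegative combination of the `a_i`, or there is `y` with `⟨a_i, y⟩ ≥ 0` for
all `i` and `⟨b, y⟩ < 0`. Induction on `m`: project everything along the last generator onto
the hyperplane `⟨·, y⟩ = 0` given by the induction hypothesis. [folklore] -/
theorem farkas_fin : ∀ (m : ℕ) (a : Fin m → κ → ℝ) (b : κ → ℝ),
    (∃ lam : Fin m → ℝ, (∀ i, 0 ≤ lam i) ∧ ∀ v, b v = ∑ i, lam i * a i v) ∨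
    (∃ y : κ → ℝ, (∀ i, 0 ≤ a i ⬝ᵥ y) ∧ b ⬝ᵥ y < 0)
  | 0, a, b => by
      by_cases hb : b = 0
      · exact Or.inl ⟨fun i => i.elim0, fun i => i.elim0, fun v => by simp [hb]⟩
      · refine Or.inr ⟨-b, fun i => i.elim0, ?_⟩
        rw [dotProduct_neg, neg_lt_zero]
        obtain ⟨i, hi⟩ : ∃ i, b i ≠ 0 := by
          by_contra h
          push Not at h
          exact hb (funext h)
        calc (0 : ℝ) < b i * b i := mul_self_pos.2 hi
          _ ≤ b ⬝ᵥ b := Finset.single_le_sum (fun j _ => mul_self_nonneg (b j)) (Finset.mem_univ i)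
  | m + 1, a, b => by
      rcases farkas_fin m (fun i => a (Fin.castSucc i)) b with ⟨lam, hlam, hb⟩ | ⟨y, hy, hby⟩
      · -- `b` already lies in the cone of the first `m` generators
        refine Or.inl ⟨Fin.snoc lam 0, fun i => ?_, fun v => ?_⟩
        · refine Fin.lastCases ?_ (fun j => ?_) i
          · simp
          · simp [hlam j]
        · rw [Fin.sum_univ_castSucc, hb v]
          simp
      · by_cases hL : 0 ≤ a (Fin.last m) ⬝ᵥ y
        · -- the separating `y` also works for the last generator
          refine Or.inr ⟨y, fun i => ?_, hby⟩
          refine Fin.lastCases ?_ (fun j => ?_) i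
          · exact hL
          · exact hy j
        · push Not at hL
          -- project along the last generator onto the hyperplane `⟨·, y⟩ = 0`
          set d : ℝ := a (Fin.last m) ⬝ᵥ y with hd
          have hdne : d ≠ 0 := hL.ne
          rcases farkas_fin m
              (fun i => a (Fin.castSucc i) - ((a (Fin.castSucc i) ⬝ᵥ y) / d) • a (Fin.last m))
              (b - ((b ⬝ᵥ y) / d) • a (Fin.last m)) with ⟨lam, hlam, hb2⟩ | ⟨z, hz, hbz⟩
          · -- lift the combination back: the coefficient of the last generator is `μ ≥ 0`
            set μ : ℝ := (b ⬝ᵥ y - ∑ i, lam i * (a (Fin.castSucc i) ⬝ᵥ y)) / d with hμ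
            have hμ0 : 0 ≤ μ := by
              refine div_nonneg_of_nonpos ?_ hL.le
              have : 0 ≤ ∑ i, lam i * (a (Fin.castSucc i) ⬝ᵥ y) :=
                Finset.sum_nonneg fun i _ => mul_nonneg (hlam i) (hy i)
              linarith
            refine Or.inl ⟨Fin.snoc lam μ, fun i => ?_, fun v => ?_⟩
            · refine Fin.lastCases ?_ (fun j => ?_) i
              · simpa using hμ0
              · simpa using hlam j
            · rw [Fin.sum_univ_castSucc]
              simp only [Fin.snoc_castSucc, Fin.snoc_last]
              have hc := hb2 v
              simp only [Pi.sub_apply, Pi.smul_apply, smul_eq_mul] at hc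
              have hsplit : ∑ i, lam i * (a (Fin.castSucc i) v -
                  (a (Fin.castSucc i) ⬝ᵥ y) / d * a (Fin.last m) v) =
                  ∑ i, lam i * a (Fin.castSucc i) v -
                    (∑ i, lam i * (a (Fin.castSucc i) ⬝ᵥ y)) / d * a (Fin.last m) v := by
                rw [Finset.sum_div, Finset.sum_mul, ← Finset.sum_sub_distrib]
                exact Finset.sum_congr rfl fun i _ => by ring
              rw [hsplit] at hc
              have hμ' : μ = (b ⬝ᵥ y) / d - (∑ i, lam i * (a (Fin.castSucc i) ⬝ᵥ y)) / d := by
                rw [hμ, sub_div]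
              rw [hμ']
              linarith
          · -- lift the separating vector back: correct `z` along `y`
            refine Or.inr ⟨z - ((a (Fin.last m) ⬝ᵥ z) / d) • y, fun i => ?_, ?_⟩
            · refine Fin.lastCases ?_ (fun j => ?_) i
              · have : a (Fin.last m) ⬝ᵥ (z - ((a (Fin.last m) ⬝ᵥ z) / d) • y) = 0 := by
                  rw [dotProduct_sub, dotProduct_smul, smul_eq_mul, ← hd, div_mul_cancel₀ _ hdne,
                    sub_self]
                exact this.ge
              · have h1 := hz j
                simp only [sub_dotProduct, smul_dotProduct, smul_eq_mul] at h1
                rw [dotProduct_sub, dotProduct_smul, smul_eq_mul]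
                have : (a (Fin.castSucc j) ⬝ᵥ y) / d * (a (Fin.last m) ⬝ᵥ z) =
                    (a (Fin.last m) ⬝ᵥ z) / d * (a (Fin.castSucc j) ⬝ᵥ y) := by ring
                linarith
            · simp only [sub_dotProduct, smul_dotProduct, smul_eq_mul] at hbz
              rw [dotProduct_sub, dotProduct_smul, smul_eq_mul]
              have : (b ⬝ᵥ y) / d * (a (Fin.last m) ⬝ᵥ z) =
                  (a (Fin.last m) ⬝ᵥ z) / d * (b ⬝ᵥ y) := by ring
              linarith

/-- **Farkas' lemma, conic form** (any finite family of generators `a_g ∈ ℝ^κ`): either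
`b = Σ_g λ_g a_g` with all `λ_g ≥ 0`, or some `y ∈ ℝ^κ` satisfies `⟨a_g, y⟩ ≥ 0` for every `g`
and `⟨b, y⟩ < 0`. [cite: FioriniEtAl2015, Lemma 2 (PDF p. 8)] -/
theorem farkas {G : Type*} [Fintype G] (a : G → κ → ℝ) (b : κ → ℝ) :
    (∃ lam : G → ℝ, (∀ g, 0 ≤ lam g) ∧ ∀ v, b v = ∑ g, lam g * a g v) ∨
    (∃ y : κ → ℝ, (∀ g, 0 ≤ a g ⬝ᵥ y) ∧ b ⬝ᵥ y < 0) := by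
  classical
  set e := Fintype.equivFin G with he
  rcases farkas_fin (Fintype.card G) (fun i => a (e.symm i)) b with ⟨lam, hlam, hb⟩ | ⟨y, hy, hby⟩
  · refine Or.inl ⟨fun g => lam (e g), fun g => hlam _, fun v => ?_⟩
    rw [hb v, ← e.sum_comp]
    simp
  · refine Or.inr ⟨y, fun g => ?_, hby⟩
    simpa using hy (e g)

end Farkas

/-! ### LP duality for slack-form systems -/

variable {ι : Type} [Fintype ι] {r : ℕ}

/-- **LP duality for an extended formulation in slack form.** If the system
`E x + F y = g, y ≥ 0` is feasible and the inequality `c · x ≤ β` is valid on its projection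
`Q.projSet`, then `c · x ≤ β` "can be derived as a conic combination of the system": there are
multipliers `λ ∈ ℝ^k` with `λᵀ E = c`, `λᵀ F ≥ 0` and `λᵀ g ≤ β` (so that
`β - c·x ≥ λᵀg - λᵀE x = (λᵀF) y ≥ 0` on every feasible `(x, y)`). Derived from `farkas` applied
in `ℝ^ι × ℝ^r × ℝ` to the generators `±(E_i, F_i, g_i)`, `(0, -e_j, 0)`, `(0, 0, 1)` and the
target `(c, 0, β)`; the alternative vector is excluded by feasibility (an improving ray) or by
validity (a violating point). [cite: Rothvoss2017, proof of Thm. 4 (PDF p. 5)] -/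
theorem ExtendedFormulation.exists_multipliers (Q : ExtendedFormulation ι r)
    (hne : Q.projSet.Nonempty) {c : ι → ℝ} {β : ℝ} (hvalid : ∀ x ∈ Q.projSet, c ⬝ᵥ x ≤ β) :
    ∃ lam : Fin Q.k → ℝ, lam ᵥ* Q.E = c ∧ (∀ j, 0 ≤ (lam ᵥ* Q.F) j) ∧ lam ⬝ᵥ Q.g ≤ β := by
  classical
  -- the homogenised rows `(E_i, F_i, g_i)`, generators and target in `V = (ι ⊕ Fin r) ⊕ Unit`
  let hrow : Fin Q.k → (ι ⊕ Fin r) ⊕ Unit → ℝ :=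
    fun i => Sum.elim (Sum.elim (Q.E i) (Q.F i)) fun _ => Q.g i
  have hrow_dot : ∀ (i : Fin Q.k) (x : ι → ℝ) (w : Fin r → ℝ) (τ : ℝ),
      hrow i ⬝ᵥ Sum.elim (Sum.elim x w) (fun _ => τ) = Q.E i ⬝ᵥ x + Q.F i ⬝ᵥ w + Q.g i * τ := by
    intro i x w τ
    simp only [hrow]
    rw [sumElim_dotProduct_sumElim, sumElim_dotProduct_sumElim]
    simp [dotProduct]
  let slackGen : Fin r → (ι ⊕ Fin r) ⊕ Unit → ℝ :=
    fun j => Sum.elim (Sum.elim 0 (-Pi.single j 1)) fun _ => 0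
  let unitGen : Unit → (ι ⊕ Fin r) ⊕ Unit → ℝ := fun _ => Sum.elim (Sum.elim 0 0) fun _ => 1
  let gen : (Fin Q.k ⊕ Fin Q.k) ⊕ (Fin r ⊕ Unit) → (ι ⊕ Fin r) ⊕ Unit → ℝ :=
    Sum.elim (Sum.elim hrow fun i => -hrow i) (Sum.elim slackGen unitGen)
  let bvec : (ι ⊕ Fin r) ⊕ Unit → ℝ := Sum.elim (Sum.elim c 0) fun _ => β
  rcases farkas gen bvec with ⟨lam, hlam, hb⟩ | ⟨Y, hY, hbY⟩
  · -- read off the multipliers `λ = λ⁺ - λ⁻`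
    refine ⟨fun i => lam (Sum.inl (Sum.inl i)) - lam (Sum.inl (Sum.inr i)), ?_, ?_, ?_⟩
    · funext i'
      have h := hb (Sum.inl (Sum.inl i'))
      simp only [bvec, gen, slackGen, unitGen, hrow, Fintype.sum_sum_type,
        Sum.elim_inl, Sum.elim_inr, Pi.neg_apply, Pi.zero_apply, mul_zero, Finset.sum_const_zero,
        add_zero, mul_neg] at h
      simp only [vecMul, dotProduct, sub_mul, Finset.sum_sub_distrib]
      rw [h, Finset.sum_neg_distrib, sub_eq_add_neg]
    · intro j'
      have h := hb (Sum.inl (Sum.inr j'))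
      simp only [bvec, gen, slackGen, unitGen, hrow, Fintype.sum_sum_type,
        Sum.elim_inl, Sum.elim_inr, Pi.neg_apply, Pi.zero_apply, mul_zero, Finset.sum_const_zero,
        add_zero, mul_neg, Pi.single_apply] at h
      simp only [vecMul, dotProduct, sub_mul, Finset.sum_sub_distrib]
      have hsingle : ∑ x : Fin r, -(lam (Sum.inr (Sum.inl x)) * if j' = x then (1 : ℝ) else 0) =
          -lam (Sum.inr (Sum.inl j')) := by
        rw [Finset.sum_neg_distrib]
        simp [Finset.sum_ite_eq]
      rw [hsingle, Finset.sum_neg_distrib] at h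
      have := hlam (Sum.inr (Sum.inl j'))
      linarith
    · have h := hb (Sum.inr ())
      simp only [bvec, gen, slackGen, unitGen, hrow, Fintype.sum_sum_type,
        Sum.elim_inl, Sum.elim_inr, Pi.neg_apply, mul_zero, Finset.sum_const_zero,
        mul_neg, mul_one, zero_add, Fintype.sum_unique] at h
      simp only [dotProduct, sub_mul, Finset.sum_sub_distrib]
      rw [Finset.sum_neg_distrib] at h
      have := hlam (Sum.inr (Sum.inr ()))
      linarith
  · -- the alternative is impossible
    exfalso
    set x : ι → ℝ := fun i => Y (Sum.inl (Sum.inl i)) with hx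
    set w : Fin r → ℝ := fun j => Y (Sum.inl (Sum.inr j)) with hw
    set τ : ℝ := Y (Sum.inr ()) with hτ
    have hYd : Y = Sum.elim (Sum.elim x w) fun _ => τ := by
      funext v; rcases v with ((i | j) | ⟨⟩) <;> rfl
    -- the four families of generator inequalities
    have hrow0 : ∀ i, Q.E i ⬝ᵥ x + Q.F i ⬝ᵥ w + Q.g i * τ = 0 := by
      intro i
      have h1 := hY (Sum.inl (Sum.inl i))
      have h2 := hY (Sum.inl (Sum.inr i))
      simp only [gen, Sum.elim_inl, Sum.elim_inr, neg_dotProduct] at h1 h2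
      rw [hYd, hrow_dot] at h1 h2
      linarith
    have hw0 : ∀ j, w j ≤ 0 := by
      intro j
      have h1 := hY (Sum.inr (Sum.inl j))
      simp only [gen, slackGen, Sum.elim_inl, Sum.elim_inr] at h1
      rw [hYd, sumElim_dotProduct_sumElim, sumElim_dotProduct_sumElim, zero_dotProduct,
        neg_dotProduct, single_dotProduct, one_mul] at h1
      simp only [dotProduct, zero_mul, Finset.sum_const_zero, add_zero, zero_add] at h1
      linarith
    have hτ0 : 0 ≤ τ := by
      have h1 := hY (Sum.inr (Sum.inr ()))
      simp only [gen, unitGen, Sum.elim_inr] at h1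
      rw [hYd, sumElim_dotProduct_sumElim, sumElim_dotProduct_sumElim, zero_dotProduct,
        zero_dotProduct] at h1
      simpa [dotProduct] using h1
    have hobj : c ⬝ᵥ x + β * τ < 0 := by
      have h1 := hbY
      simp only [bvec] at h1
      rw [hYd, sumElim_dotProduct_sumElim, sumElim_dotProduct_sumElim, zero_dotProduct] at h1
      simpa [dotProduct] using h1
    -- the homogeneous relation `E(-x) + F(-w) = τ g`
    have hsys : ∀ s : ℝ, ∀ x₀ : ι → ℝ, ∀ y₀ : Fin r → ℝ, Q.E *ᵥ x₀ + Q.F *ᵥ y₀ = Q.g →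
        Q.E *ᵥ (x₀ - s • x) + Q.F *ᵥ (y₀ - s • w) = (1 + s * τ) • Q.g := by
      intro s x₀ y₀ h0
      funext i
      have h0i := congrFun h0 i
      simp only [Pi.add_apply, mulVec, Pi.smul_apply, smul_eq_mul] at h0i ⊢
      rw [dotProduct_sub, dotProduct_sub, dotProduct_smul, dotProduct_smul, smul_eq_mul, smul_eq_mul]
      have := hrow0 i
      show (fun j => Q.E i j) ⬝ᵥ x₀ - s * ((fun j => Q.E i j) ⬝ᵥ x) +
          ((fun j => Q.F i j) ⬝ᵥ y₀ - s * ((fun j => Q.F i j) ⬝ᵥ w)) = (1 + s * τ) * Q.g i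
      have hE : (fun j => Q.E i j) = Q.E i := rfl
      have hF : (fun j => Q.F i j) = Q.F i := rfl
      rw [hE, hF] at h0i ⊢
      linear_combination h0i - s * this
    obtain ⟨x₀, y₀, hy₀, h0⟩ := hne
    rcases hτ0.lt_or_eq with hτpos | hτzero
    · -- `τ > 0`: the point `-x/τ` is feasible and violates `c · x ≤ β`
      have hfeas : (-(1 / τ)) • x ∈ Q.projSet := by
        refine ⟨(-(1 / τ)) • w, fun j => ?_, ?_⟩
        · simp only [Pi.smul_apply, smul_eq_mul]
          have := hw0 j
          have : 0 < 1 / τ := by positivity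
          nlinarith
        · funext i
          simp only [Pi.add_apply, mulVec, smul_eq_mul, dotProduct_smul]
          have := hrow0 i
          have hE : (fun j => Q.E i j) = Q.E i := rfl
          have hF : (fun j => Q.F i j) = Q.F i := rfl
          rw [hE, hF]
          field_simp
          linarith
      have hle := hvalid _ hfeas
      rw [dotProduct_smul, smul_eq_mul] at hle
      have hmul : -(1 / τ) * (c ⬝ᵥ x) * τ ≤ β * τ := mul_le_mul_of_nonneg_right hle hτpos.le
      have hsimp : -(1 / τ) * (c ⬝ᵥ x) * τ = -(c ⬝ᵥ x) := by field_simp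
      linarith
    · -- `τ = 0`: `(-x, -w)` is an improving feasible direction
      have hcx : c ⬝ᵥ x < 0 := by rw [← hτzero] at hobj; simpa using hobj
      have hβ0 : c ⬝ᵥ x₀ ≤ β := hvalid x₀ ⟨y₀, hy₀, h0⟩
      set s : ℝ := (β - c ⬝ᵥ x₀ + 1) / (-(c ⬝ᵥ x)) with hs
      have hs0 : 0 ≤ s := div_nonneg (by linarith) (by linarith)
      have hfeas : x₀ - s • x ∈ Q.projSet := by
        refine ⟨y₀ - s • w, fun j => ?_, ?_⟩
        · simp only [Pi.sub_apply, Pi.smul_apply, smul_eq_mul]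
          have := hw0 j
          have := hy₀ j
          nlinarith
        · rw [hsys s x₀ y₀ h0, ← hτzero, mul_zero, add_zero, one_smul]
      have hle := hvalid _ hfeas
      rw [dotProduct_sub, dotProduct_smul, smul_eq_mul] at hle
      have hcx0 : c ⬝ᵥ x ≠ 0 := hcx.ne
      have hsx : s * (c ⬝ᵥ x) = -(β - c ⬝ᵥ x₀ + 1) := by
        rw [hs, div_mul_eq_mul_div, div_eq_iff (neg_ne_zero.2 hcx0)]
        ring
      linarith

end Literature.Barriers.PneNP

end
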